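import Literature.NumberTheory.EllipticCurves.QuadraticTwistPadicSquareProofs
import HarnessLib

/-!
# `λ_p(f) = (−1/p)` at an additive prime of quadratic-twist type, without the hypothesis at `2, 3` — proofs

A `…Proofs` file (theorems only). The tree's `atkinLehnerEigenvalueAt_eq_localRootNumberAt_of_twist`
(`RootNumberTwistProofs`; Kellock–Dokchitser 2023, Rem. 2.2 at an additive prime `p ≥ 5` with `E^{(p*)}`
semistable at `p`) carries the hypothesis "no additive reduction at `2, 3`", used only inside its conductor
lemma `conductorNorm_eq_mul_sq_of_twist` to bound `f_q(E^{(p*)}) ≤ f_q(E)` at the OTHER additive primes `q`.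
Here the same two statements are proved with that bound as an explicit hypothesis (`hle`) and with
`f_p(E) = 2` as a hypothesis (`hfp`) instead of `p ≥ 5` — so that they apply at `p = 3` (additive,
potentially multiplicative: Kodaira `Iₙ*`, `f_3 = 2`) and to curves additive at `3`:

* `conductorNorm_eq_mul_sq_of_twist_of_le` — `N_E = M p²`, `p ∤ M`, `N_{E^{(p*)}} ∣ M p`;
* `atkinLehnerEigenvalueAt_eq_χ₄_of_twist_of_le` — `λ_p(f_E) = (−1/p)` (modular side of Rem. 2.2: `f_E` is
  the twist of `f_{E^{(p*)}}` by `(·/p)`, Atkin–Lehner 1970 §6 / Atkin–Li 1978 §3, the tree's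
  `atkinLehnerEigenvalueAt_eq_χ₄_of_cuspCoeff_eq`).

Also two more transfers along a twist by a `p`-adic square (sequel of `QuadraticTwistPadicSquareProofs`):
good and multiplicative reduction. No definitions, no named facts.

References: [KellockDokchitser2023] Bull. LMS 55 (2023), Rem. 2.2; [AtkinLi1978] Invent. Math. 48 (1978), §3;
[SilvermanATAEC1994] Thm. IV.10.2; [SilvermanAEC2009] VII.5 Prop. 5.1.
-/

noncomputable section

open scoped MatrixGroups Classical

open CongruenceSubgroup Literature.NumberTheory.EllipticCurves.ModularForms IsDedekindDomain
  IsDedekindDomain.HeightOneSpectrum NumberField Rat.HeightOneSpectrum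

namespace WeierstrassCurve

variable (W : WeierstrassCurve ℚ)

/-! ### §1 Good and multiplicative reduction along a twist by a `p`-adic square -/

section LocalSquare

variable {p : ℕ} [Fact p.Prime]

/-- Good reduction over `ℤ_p` of a twist by a `p`-adic square iff of the curve (Silverman, *AEC* VII.5
Prop. 5.1 (a), VII.1 Prop. 1.3 (b)). [cite: SilvermanAEC2009, VII.5 Prop. 5.1] -/
theorem hasGoodReduction_padic_quadraticTwist_iff_of_isSquare [W.IsElliptic] {d : ℤ} (hd : d ≠ 0)
    (hsq : IsSquare ((d : ℤ) : ℚ_[p])) :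
    (((W.quadraticTwist (d : ℚ)).baseChange ℚ_[p]).minimal ℤ_[p]).HasGoodReduction ℤ_[p] ↔
      ((W.baseChange ℚ_[p]).minimal ℤ_[p]).HasGoodReduction ℤ_[p] := by
  haveI : (W.baseChange ℚ_[p]).IsElliptic := by change (W.map _).IsElliptic; infer_instance
  haveI : ((W.baseChange ℚ_[p]).minimal ℤ_[p]).IsElliptic := by unfold minimal; infer_instance
  obtain ⟨C, hC⟩ := W.exists_variableChange_baseChange_quadraticTwist_of_isSquare hd hsq
  obtain ⟨D, hD⟩ : ∃ D : VariableChange ℚ_[p],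
      (W.baseChange ℚ_[p]).minimal ℤ_[p] = D • W.baseChange ℚ_[p] := ⟨_, rfl⟩
  obtain ⟨D', hD'⟩ : ∃ D' : VariableChange ℚ_[p],
      ((W.quadraticTwist (d : ℚ)).baseChange ℚ_[p]).minimal ℤ_[p] =
        D' • (W.quadraticTwist (d : ℚ)).baseChange ℚ_[p] := ⟨_, rfl⟩
  have hrel : ((W.quadraticTwist (d : ℚ)).baseChange ℚ_[p]).minimal ℤ_[p] =
      (D' * C * D⁻¹) • (W.baseChange ℚ_[p]).minimal ℤ_[p] := by
    rw [hD', hC, mul_smul, mul_smul, hD, inv_smul_smul]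
  exact hasGoodReduction_iff_of_isMinimal_of_eq_smul ℤ_[p] hrel

/-- Multiplicative reduction over `ℤ_p` of a twist by a `p`-adic square iff of the curve.
[cite: SilvermanAEC2009, VII.5 Prop. 5.1] -/
theorem hasMultiplicativeReduction_padic_quadraticTwist_iff_of_isSquare [W.IsElliptic] {d : ℤ} (hd : d ≠ 0)
    (hsq : IsSquare ((d : ℤ) : ℚ_[p])) :
    (((W.quadraticTwist (d : ℚ)).baseChange ℚ_[p]).minimal ℤ_[p]).HasMultiplicativeReduction ℤ_[p] ↔
      ((W.baseChange ℚ_[p]).minimal ℤ_[p]).HasMultiplicativeReduction ℤ_[p] := by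
  haveI : (W.baseChange ℚ_[p]).IsElliptic := by change (W.map _).IsElliptic; infer_instance
  haveI : ((W.baseChange ℚ_[p]).minimal ℤ_[p]).IsElliptic := by unfold minimal; infer_instance
  obtain ⟨C, hC⟩ := W.exists_variableChange_baseChange_quadraticTwist_of_isSquare hd hsq
  obtain ⟨D, hD⟩ : ∃ D : VariableChange ℚ_[p],
      (W.baseChange ℚ_[p]).minimal ℤ_[p] = D • W.baseChange ℚ_[p] := ⟨_, rfl⟩
  obtain ⟨D', hD'⟩ : ∃ D' : VariableChange ℚ_[p],
      ((W.quadraticTwist (d : ℚ)).baseChange ℚ_[p]).minimal ℤ_[p] =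
        D' • (W.quadraticTwist (d : ℚ)).baseChange ℚ_[p] := ⟨_, rfl⟩
  have hrel : ((W.quadraticTwist (d : ℚ)).baseChange ℚ_[p]).minimal ℤ_[p] =
      (D' * C * D⁻¹) • (W.baseChange ℚ_[p]).minimal ℤ_[p] := by
    rw [hD', hC, mul_smul, mul_smul, hD, inv_smul_smul]
  exact hasMultiplicativeReduction_iff_of_isMinimal_of_eq_smul ℤ_[p] hrel
    ((W.baseChange ℚ_[p]).minimal ℤ_[p]).isUnit_Δ.ne_zero

/-- Place-indexed form: `E^{(d)}` is good at the place of `ℤ` under `p` iff `E` is, for `d` a `p`-adic square.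
[cite: SilvermanAEC2009, VII.5 Prop. 5.1] -/
theorem hasGoodReductionAt_quadraticTwist_iff_of_isSquare [W.IsElliptic] (p : Nat.Primes) {d : ℤ}
    (hd : d ≠ 0) (hsq : haveI := Fact.mk p.2; IsSquare ((d : ℤ) : ℚ_[p])) :
    (W.quadraticTwist (d : ℚ)).HasGoodReductionAt ((primesEquiv (R := ℤ)).symm p) ↔
      W.HasGoodReductionAt ((primesEquiv (R := ℤ)).symm p) := by
  haveI := Fact.mk p.2
  haveI := W.isElliptic_quadraticTwist (show (d : ℚ) ≠ 0 by exact_mod_cast hd)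
  rw [← W.hasGoodReductionAtPrime_iff_hasGoodReductionAt_holds p,
    ← (W.quadraticTwist (d : ℚ)).hasGoodReductionAtPrime_iff_hasGoodReductionAt_holds p]
  exact W.hasGoodReduction_padic_quadraticTwist_iff_of_isSquare hd hsq

/-- Place-indexed form: `E^{(d)}` is multiplicative at the place of `ℤ` under `p` iff `E` is, for `d` a
`p`-adic square. [cite: SilvermanAEC2009, VII.5 Prop. 5.1] -/
theorem hasMultiplicativeReductionAt_quadraticTwist_iff_of_isSquare [W.IsElliptic] (p : Nat.Primes) {d : ℤ}
    (hd : d ≠ 0) (hsq : haveI := Fact.mk p.2; IsSquare ((d : ℤ) : ℚ_[p])) :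
    (W.quadraticTwist (d : ℚ)).HasMultiplicativeReductionAt ((primesEquiv (R := ℤ)).symm p) ↔
      W.HasMultiplicativeReductionAt ((primesEquiv (R := ℤ)).symm p) := by
  haveI := Fact.mk p.2
  haveI := W.isElliptic_quadraticTwist (show (d : ℚ) ≠ 0 by exact_mod_cast hd)
  rw [← W.hasMultiplicativeReductionAtPrime_iff_hasMultiplicativeReductionAt_holds p,
    ← (W.quadraticTwist (d : ℚ)).hasMultiplicativeReductionAtPrime_iff_hasMultiplicativeReductionAt_holds p]
  exact W.hasMultiplicativeReduction_padic_quadraticTwist_iff_of_isSquare hd hsq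

end LocalSquare

/-! ### §2 The conductors of `E` and `E^{(p*)}` at an additive prime of twist type, `f_p(E) = 2` given -/

/-- **`N_E = M p²` with `p ∤ M` and `N_{E'} ∣ M p`** for `E' = E^{(p*)}`, `p` an odd prime with `f_p(E) = 2`
(so additive for `E`) at which `E'` is not additive, PROVIDED `f_q(E') ≤ f_q(E)` at every other additive
prime `q` of `E` (`hle`; automatic for `q ≥ 5`, where both are `2`). At the good and multiplicative primes
`q ≠ p` the reduction types of `E'` and `E` agree (`hasReductionAt_quadraticTwist_pStar_iff`). The tree's
`conductorNorm_eq_mul_sq_of_twist` is the case `p ≥ 5`, no additive reduction at `2, 3`.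
[cite: SilvermanATAEC1994, Thm. IV.10.2] -/
theorem conductorNorm_eq_mul_sq_of_twist_of_le [W.IsElliptic] (p : Nat.Primes) (hp2 : (p : ℕ) ≠ 2)
    (hsemi : ¬ (W.quadraticTwist (((-1 : ℤ) ^ ((p : ℕ) / 2) * p : ℤ) : ℚ)).HasAdditiveReductionAt
      ((primesEquiv (R := ℤ)).symm p))
    (hfp : W.conductorExponent ((primesEquiv (R := ℤ)).symm p) = 2)
    (hle : ∀ v : HeightOneSpectrum ℤ, natGenerator v ≠ p → W.HasAdditiveReductionAt v →
      (W.quadraticTwist (((-1 : ℤ) ^ ((p : ℕ) / 2) * p : ℤ) : ℚ)).conductorExponent v ≤ W.conductorExponent v) :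
    ∃ M : ℕ, W.conductorNorm ℤ = M * (p : ℕ) ^ 2 ∧ ¬ (p : ℕ) ∣ M ∧
      (W.quadraticTwist (((-1 : ℤ) ^ ((p : ℕ) / 2) * p : ℤ) : ℚ)).conductorNorm ℤ ∣ M * p := by
  haveI := Fact.mk p.2
  set d : ℤ := (-1 : ℤ) ^ ((p : ℕ) / 2) * p with hd
  have hd0 : (d : ℚ) ≠ 0 := by
    have : d ≠ 0 := mul_ne_zero (pow_ne_zero _ (by norm_num)) (by exact_mod_cast p.2.ne_zero)
    exact_mod_cast this
  set W' := W.quadraticTwist (d : ℚ) with hW'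
  haveI : W'.IsElliptic := W.isElliptic_quadraticTwist hd0
  have hgen : ∀ q : Nat.Primes, natGenerator ((primesEquiv (R := ℤ)).symm q) = q := fun q ↦
    congrArg (fun q : Nat.Primes ↦ (q : ℕ)) ((primesEquiv (R := ℤ)).apply_symm_apply q)
  set v₀ : HeightOneSpectrum ℤ := (primesEquiv (R := ℤ)).symm p with hv₀
  have hgen₀ : natGenerator v₀ = p := by rw [hv₀]; exact hgen p
  set N := W.conductorNorm ℤ with hN
  have hN0 : N ≠ 0 := (W.conductorNorm_pos_holds).ne'
  have hN'0 : W'.conductorNorm ℤ ≠ 0 := (W'.conductorNorm_pos_holds).ne'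
  have hfacp : N.factorization p = 2 := by
    have h := factorization_conductorNorm_holds W v₀
    rwa [hgen₀, hfp] at h
  obtain ⟨M, hM⟩ : (p : ℕ) ^ 2 ∣ N := by rw [← hfacp]; exact Nat.ordProj_dvd N p
  have hNM : N = M * (p : ℕ) ^ 2 := by rw [hM, mul_comm]
  have hpM : ¬ (p : ℕ) ∣ M := by
    have h := Nat.not_dvd_ordCompl p.2 hN0
    rwa [hfacp, hM, Nat.mul_div_cancel_left _ (pow_pos p.2.pos 2)] at h
  have hM0 : M ≠ 0 := fun h ↦ hN0 (by rw [hNM, h, zero_mul])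
  have hMp0 : M * p ≠ 0 := mul_ne_zero hM0 p.2.ne_zero
  refine ⟨M, hNM, hpM, (Nat.factorization_le_iff_dvd hN'0 hMp0).mp (Finsupp.le_def.mpr fun q ↦ ?_)⟩
  rw [Nat.factorization_mul hM0 p.2.ne_zero, Finsupp.add_apply]
  by_cases hq : q.Prime
  swap
  · rw [Nat.factorization_eq_zero_of_not_prime _ hq]; exact Nat.zero_le _
  set vq : HeightOneSpectrum ℤ := (primesEquiv (R := ℤ)).symm ⟨q, hq⟩ with hvq
  have hgenq : natGenerator vq = q := by rw [hvq]; exact hgen ⟨q, hq⟩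
  have hfq : (W'.conductorNorm ℤ).factorization q = W'.conductorExponent vq := by
    have h := factorization_conductorNorm_holds W' vq
    rwa [hgenq] at h
  rw [hfq]
  by_cases hqp : q = p
  · subst hqp
    have hvq₀ : vq = v₀ := by rw [hvq, hv₀]; exact congrArg _ (Subtype.ext rfl)
    rw [p.2.factorization_self]
    have h1 : W'.conductorExponent vq ≤ 1 := by
      rw [hvq₀]
      rcases hasGoodReductionAt_or_hasMultiplicativeReductionAt_or_hasAdditiveReductionAt v₀ W' with
        hg | hm | ha
      · rw [(conductorExponent_eq_zero_iff_holds v₀ W').mpr hg]; exact zero_le_one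
      · rw [(conductorExponent_eq_one_iff_holds v₀ W').mpr hm]
      · exact absurd ha hsemi
    omega
  · have hvqp : natGenerator vq ≠ p := by rwa [hgenq]
    obtain ⟨hg', hm', -⟩ := W.hasReductionAt_quadraticTwist_pStar_iff hp2 vq hvqp
    have hpq : (p : ℕ).factorization q = 0 := by
      rw [p.2.factorization, Finsupp.single_apply, if_neg (Ne.symm hqp)]
    rw [hpq, add_zero]
    have hMq : M.factorization q = N.factorization q := by
      rw [hNM, Nat.factorization_mul hM0 (pow_ne_zero _ p.2.ne_zero), Finsupp.add_apply,
        Nat.factorization_pow, Finsupp.smul_apply, hpq, smul_zero, add_zero]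
    have hfWq : N.factorization q = W.conductorExponent vq := by
      have h := factorization_conductorNorm_holds W vq
      rwa [hgenq] at h
    rw [hMq, hfWq]
    rcases hasGoodReductionAt_or_hasMultiplicativeReductionAt_or_hasAdditiveReductionAt vq W with
      hg | hm | ha
    · rw [(conductorExponent_eq_zero_iff_holds vq W').mpr (hg'.mpr hg)]; exact Nat.zero_le _
    · rw [(conductorExponent_eq_one_iff_holds vq W').mpr (hm'.mpr hm),
        (conductorExponent_eq_one_iff_holds vq W).mpr hm]
    · exact hle vq hvqp ha

/-- **`λ_p(f_E) = (−1/p)` at an odd additive prime `p` of quadratic-twist type with `f_p(E) = 2`**, from the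
Modularity Theorem, PROVIDED `f_q(E^{(p*)}) ≤ f_q(E)` at the other additive primes (`hle`): the newform `f`
of `E` is the twist of the newform `f'` of `E' = E^{(p*)}` by `(·/p)` (`aₙ(f) = (n/p) aₙ(f')`,
`cuspCoeff_eq_legendreSym_mul_cuspCoeff`), `N_E = M p²`, `p ∤ M`, `N_{E'} ∣ M p`
(`conductorNorm_eq_mul_sq_of_twist_of_le`), hence `λ_p(f) = χ(−1) = (−1/p)`
(`atkinLehnerEigenvalueAt_eq_χ₄_of_cuspCoeff_eq`; Atkin–Li 1978 §3). The modular half of Kellock–Dokchitser's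
Remark 2.2, valid also at `p = 3` and for curves additive at `3`. [cite: KellockDokchitser2023, Rem. 2.2]
[cite: AtkinLi1978, §3] -/
theorem atkinLehnerEigenvalueAt_eq_χ₄_of_twist_of_le (hmod : exists_isNewformOf) [W.IsElliptic]
    [NeZero (W.conductorNorm ℤ)] {f : CuspForm (Gamma0 (W.conductorNorm ℤ)) 2} (hf : IsNewformOf W f)
    (p : Nat.Primes) (hp2 : (p : ℕ) ≠ 2) (hadd : W.HasAdditiveReductionAt ((primesEquiv (R := ℤ)).symm p))
    (hsemi : ¬ (W.quadraticTwist (((-1 : ℤ) ^ ((p : ℕ) / 2) * p : ℤ) : ℚ)).HasAdditiveReductionAt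
      ((primesEquiv (R := ℤ)).symm p))
    (hfp : W.conductorExponent ((primesEquiv (R := ℤ)).symm p) = 2)
    (hle : ∀ v : HeightOneSpectrum ℤ, natGenerator v ≠ p → W.HasAdditiveReductionAt v →
      (W.quadraticTwist (((-1 : ℤ) ^ ((p : ℕ) / 2) * p : ℤ) : ℚ)).conductorExponent v ≤ W.conductorExponent v) :
    atkinLehnerEigenvalueAt f p = (ZMod.χ₄ p : ℂ) := by
  haveI := Fact.mk p.2
  obtain ⟨M, hNM, hpM, hN'⟩ := W.conductorNorm_eq_mul_sq_of_twist_of_le p hp2 hsemi hfp hle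
  set d : ℤ := (-1 : ℤ) ^ ((p : ℕ) / 2) * p with hd
  have hd0 : (d : ℚ) ≠ 0 := by
    have : d ≠ 0 := mul_ne_zero (pow_ne_zero _ (by norm_num)) (by exact_mod_cast p.2.ne_zero)
    exact_mod_cast this
  set W' := W.quadraticTwist (d : ℚ) with hW'
  haveI : W'.IsElliptic := W.isElliptic_quadraticTwist hd0
  haveI : NeZero (W'.conductorNorm ℤ) := ⟨(W'.conductorNorm_pos_holds).ne'⟩
  obtain ⟨f', hf'⟩ := hmod W'
  set v : HeightOneSpectrum (𝓞 ℚ) := (primesEquiv (R := 𝓞 ℚ)).symm p with hv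
  have hvp : (primesEquiv v : ℕ) = p := by rw [hv, Equiv.apply_symm_apply]
  have haddO : W.HasAdditiveReductionAt v := (W.hasAdditiveReductionAt_int_iff_ringOfIntegers p).mp hadd
  have hcoeff : ∀ n : ℕ, cuspCoeff f n = (legendreSym p n : ℂ) * cuspCoeff f' n :=
    W.cuspCoeff_eq_legendreSym_mul_cuspCoeff hp2 hvp haddO hf hf'
  have hf0 : f ≠ 0 := fun h0 ↦ hf.1.coe_ne_zero (by rw [h0]; rfl)
  exact atkinLehnerEigenvalueAt_eq_χ₄_of_cuspCoeff_eq hp2 hNM hpM hN' hf0 hcoeff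

end WeierstrassCurve

end
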